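import Summits.CriticalPhenomena.PercolationContinuityZ3.Theorems.Transplant.BoxProdZ2Kits
import Summits.CriticalPhenomena.PercolationContinuityZ3.Theorems.Transplant.BoxProdZ2DeepRoute
import HarnessLib

/-!
# The kits of a PRODUCT CORRIDOR STEP: the deep branch of `kitClause`'s per-contact dichotomy from a planar ROOM and fibre DEEPNESS, and
# the planar position of a contact's cube centre (F8-DESIGN §9 "KitsAt"; BLUEPRINT-I-PHI §1 rows "Lemma 11/12", "cube behind a contact")

builds on p205010 (kernel theorem, internal audit signed; external expert review pending) — nothing in this file uses p205010.
Lane `prim-bschramm`, seat `prim-bschramm-p3` (for p2-g2's `KNCellsBoxProdZ2Chain`); helper file (`--supports stmt-CriticalPhenomena-4575 --as helper`).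

A product step runs the tube-level target lemma in `tubeGraph X π`, `π = B_X(β, R_w)`, with levels `π × Icc (lo - j) (hi + j)`, subbox
`D = π × Dpl` and target `T ⊇ π × Tpl`.  `kitClause` (p3, `BoxProdZ2Kits`) asks at every candidate contact `x` EITHER a thick-face vertex in
`T` (edge contacts) OR a frame `γ` with a target route.  This file discharges the second branch from the two inputs p2-g2's chain schedule
provides (`core_route`): a planar ROOM `v + Λ_ℓ ⊆ Dpl`, `v + (orthant face of Λ_ℓ) ⊆ Tpl` at the cube centre `v = v(P)` of the contact, some
`ℓ > M`, and fibre DEEPNESS `B_X(c_x, ψ ℓ) ⊆ π` of the retracted fibre centre `c_x`: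
* `vctr_mem_level` — the cube centre of a contact of level `j` lies in `Icc (lo - j) (hi + j)` (input of `core_route`'s enlargement);
* `frameSeq_subset_of_room` / `fatFace_subset_of_room` — the frame prism of scale `ℓ` lies in `π × Dpl`, its fat orthant face in `π × Tpl`;
* **`hcon_of_room`** — the deep disjunct of `kitClause`'s `hcon`, via `deep_h3` and the link estimate of `exists_scales` at scale `ℓ`.

[cite: KozmaNitzan2024, §4 Lemma 11 (p. 23), Lemma 12 (p. 24), pp. 19–21 — the ℤ^d model]
-/

noncomputable section

open MeasureTheory

namespace Summit.CriticalPhenomena.PercolationContinuityZ3.Theorems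

namespace Transplant

namespace BoxProdZ2

open Literature.Probability.Percolation Literature.Probability.LatticeModels SimpleGraph KNLevels KozmaNitzan
open Literature.Probability.Percolation.GM
open Literature.Barriers.CriticalPhenomena (graphBall graphBall_finite mem_graphBall_self graphBall_mono)

variable {W : Type} [DecidableEq W] (X : SimpleGraph W) [X.LocallyFinite]

/-- **The cube centre of a contact of level `j` lies in the level box `Icc (lo - j) (hi + j)`** (indeed in its shrink by one).
[cite: KozmaNitzan2024, §4 p. 19 (v + Λ_M ⊆ S)] -/
theorem vctr_mem_level {xe : W} {Rw : ℕ} {lo hi : Site 2} {j M : ℕ}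
    (hwide : ∀ k, (lo - ((j : ℕ) : Site 2)) k + 2 * M + 2 ≤ (hi + ((j : ℕ) : Site 2)) k) {x : W × Site 2}
    (hx : x ∈ outerBoundary (tubeGraph X (ballFin X xe Rw)) (tubeLevel (ballFin X xe Rw) lo hi j)) :
    vctr (lo - ((j : ℕ) : Site 2)) (hi + ((j : ℕ) : Site 2)) M (pwin (lo - ((j : ℕ) : Site 2)) (hi + ((j : ℕ) : Site 2)) M x.2).1
        (pwin (lo - ((j : ℕ) : Site 2)) (hi + ((j : ℕ) : Site 2)) M x.2).2.1 (pwin (lo - ((j : ℕ) : Site 2)) (hi + ((j : ℕ) : Site 2)) M x.2).2.2 ∈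
      Finset.Icc (lo - ((j : ℕ) : Site 2)) (hi + ((j : ℕ) : Site 2)) := by
  obtain ⟨-, hW, -⟩ := kit_contact (X := X) hwide hx
  have h := vctr_mem_shrink hW
  rw [mem_Icc_iff] at h ⊢
  intro k; have := h k; simp only [Pi.add_apply, Pi.sub_apply, Pi.one_apply, Pi.natCast_apply] at this ⊢; constructor <;> omega

/-- The frame prism of a contact at scale `ℓ`, unfolded: `B_X(c_x, ψ ℓ) × (v + Λ_ℓ)`. [folklore] -/
theorem frameSeq_eq_product [Countable W] {p : unitInterval} (hT : TubeSubcritical X p) (V₀ : Finset W) (γ : X ≃g X) (v : Site 2)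
    (c : W) (ℓ : ℕ) :
    frameSeq X hT V₀ γ v (γ c) ℓ = ballFin X c (ufatRadius X hT V₀ ℓ) ×ˢ (box 2 ℓ).image (fun t => t + v) := by
  rw [frameSeq, image_frame_ufatSeq, γ.symm_apply_apply]

/-- **ROOM + DEEPNESS ⇒ the frame prism fits**: `frameSeq ℓ ⊆ π × Dpl`. [folklore] -/
theorem frameSeq_subset_of_room [Countable W] {p : unitInterval} (hT : TubeSubcritical X p) (V₀ : Finset W) (γ : X ≃g X) {v : Site 2}
    {c : W} {ℓ : ℕ} {π : Finset W} {Dpl : Finset (Site 2)} (hdeep : ballFin X c (ufatRadius X hT V₀ ℓ) ⊆ π)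
    (hroom : (box 2 ℓ).image (fun t => t + v) ⊆ Dpl) : frameSeq X hT V₀ γ v (γ c) ℓ ⊆ π ×ˢ Dpl := by
  rw [frameSeq_eq_product]
  exact Finset.product_subset_product hdeep hroom

/-- **ROOM + DEEPNESS ⇒ the fat orthant face lands in the target**: `frame(B(τ, ψ ℓ) × orthantFace) ⊆ π × Tpl`. [folklore] -/
theorem fatFace_subset_of_room [Countable W] {p : unitInterval} (hT : TubeSubcritical X p) (V₀ : Finset W) (γ : X ≃g X) {v : Site 2}
    {c : W} {ℓ : ℕ} {π : Finset W} {Tpl : Finset (Site 2)} (hdeep : ballFin X c (ufatRadius X hT V₀ ℓ) ⊆ π) {a : Fin 2}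
    {τ' : Fin 2 → ℤˣ} (hroom : (orthantFace a τ' ℓ).image (fun t => t + v) ⊆ Tpl) :
    (ballFin X (γ c) (ufatRadius X hT V₀ ℓ) ×ˢ orthantFace a τ' ℓ).image (prodFrameIso X γ.symm v) ⊆ π ×ˢ Tpl := by
  rw [image_prodFrameIso_product, image_ballFin_iso, γ.symm_apply_apply]
  exact Finset.product_subset_product hdeep hroom

/-- **The deep branch of `kitClause`'s per-contact dichotomy, from a planar room and fibre deepness.**  Inputs: the link estimate of
`exists_scales` at scale `ℓ > M` (`hlink`), a subbox weighting `Wt` of the tube graph over `π = B_X(xe, Rw)` on `D = π × Dpl`, a target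
`T ⊇ π × Tpl`, a candidate contact `x` of the level `π × Icc (lo - j) (hi + j)` with frame `γ` (`γ c_x ∈ V₀`), DEEPNESS `B_X(c_x, ψ ℓ) ⊆ π`, and the
ROOM at its cube centre `v`: `v + Λ_ℓ ⊆ Dpl` and `v + orthantFace a τ' ℓ ⊆ Tpl`.  Output: the `∃ γ Qt Ft, …` disjunct of `kitClause`'s `hcon`.
[cite: KozmaNitzan2024, §4 Lemma 11 (p. 23), p. 21 ((24)–(25))] -/
theorem hcon_of_room [Countable W] {p : unitInterval} (hT : TubeSubcritical X p) (V₀ : Finset W) {δ : ℝ} {msel : W → ℕ} {M ℓ : ℕ}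
    (hMℓ : M < ℓ)
    (hlink : ∀ τ ∈ V₀, ∀ g : HOct 2, 1 - δ ^ 2 < (bondPercolation (X □ zdGraph 2) p).real
      (linkIn (↑(ufatSeq X hT V₀ τ ℓ)) (ufatSeq X hT V₀ τ (msel τ)) (ballFin X τ (ufatRadius X hT V₀ ℓ) ×ˢ piece g ℓ)))
    {xe : W} {Rw : ℕ} {lo hi : Site 2} {j : ℕ} {Wt : Sym2 (W × Site 2) → unitInterval} {Dpl Tpl : Finset (Site 2)}
    {T : Finset (W × Site 2)} (hWD : IsSubbox (tubeGraph X (ballFin X xe Rw)) Wt p (ballFin X xe Rw ×ˢ Dpl))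
    (hTsub : ballFin X xe Rw ×ˢ Tpl ⊆ T) {x : W × Site 2} (γ : X ≃g X) (hγ : γ (fibCtrT X xe Rw (ufatRadius X hT V₀ M) x.1) ∈ V₀)
    (hdeep : ballFin X (fibCtrT X xe Rw (ufatRadius X hT V₀ M) x.1) (ufatRadius X hT V₀ ℓ) ⊆ ballFin X xe Rw)
    (hroomD : (box 2 ℓ).image (fun t => t + vctr (lo - ((j : ℕ) : Site 2)) (hi + ((j : ℕ) : Site 2)) M
      (pwin (lo - ((j : ℕ) : Site 2)) (hi + ((j : ℕ) : Site 2)) M x.2).1 (pwin (lo - ((j : ℕ) : Site 2)) (hi + ((j : ℕ) : Site 2)) M x.2).2.1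
      (pwin (lo - ((j : ℕ) : Site 2)) (hi + ((j : ℕ) : Site 2)) M x.2).2.2) ⊆ Dpl)
    {a : Fin 2} {τ' : Fin 2 → ℤˣ}
    (hroomT : (orthantFace a τ' ℓ).image (fun t => t + vctr (lo - ((j : ℕ) : Site 2)) (hi + ((j : ℕ) : Site 2)) M
      (pwin (lo - ((j : ℕ) : Site 2)) (hi + ((j : ℕ) : Site 2)) M x.2).1 (pwin (lo - ((j : ℕ) : Site 2)) (hi + ((j : ℕ) : Site 2)) M x.2).2.1
      (pwin (lo - ((j : ℕ) : Site 2)) (hi + ((j : ℕ) : Site 2)) M x.2).2.2) ⊆ Tpl) :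
    ∃ (γ' : X ≃g X) (Qt Ft : Finset (W × Site 2)), γ' (fibCtrT X xe Rw (ufatRadius X hT V₀ M) x.1) ∈ V₀ ∧ Ft ⊆ T ∧ Qt ⊆ ballFin X xe Rw ×ˢ Dpl ∧
      Disjoint Ft (kitCube X xe Rw (lo - ((j : ℕ) : Site 2)) (hi + ((j : ℕ) : Site 2)) M (ufatRadius X hT V₀ M) x) ∧
      1 - δ ^ 2 < (prodBernoulli Wt).real (linkIn (↑Qt)
        (frameSeq X hT V₀ γ' (vctr (lo - ((j : ℕ) : Site 2)) (hi + ((j : ℕ) : Site 2)) M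
          (pwin (lo - ((j : ℕ) : Site 2)) (hi + ((j : ℕ) : Site 2)) M x.2).1 (pwin (lo - ((j : ℕ) : Site 2)) (hi + ((j : ℕ) : Site 2)) M x.2).2.1
          (pwin (lo - ((j : ℕ) : Site 2)) (hi + ((j : ℕ) : Site 2)) M x.2).2.2) (γ' (fibCtrT X xe Rw (ufatRadius X hT V₀ M) x.1))
          (msel (γ' (fibCtrT X xe Rw (ufatRadius X hT V₀ M) x.1)))) Ft) := by
  set v := vctr (lo - ((j : ℕ) : Site 2)) (hi + ((j : ℕ) : Site 2)) M (pwin (lo - ((j : ℕ) : Site 2)) (hi + ((j : ℕ) : Site 2)) M x.2).1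
    (pwin (lo - ((j : ℕ) : Site 2)) (hi + ((j : ℕ) : Site 2)) M x.2).2.1 (pwin (lo - ((j : ℕ) : Site 2)) (hi + ((j : ℕ) : Site 2)) M x.2).2.2 with hv
  set c := fibCtrT X xe Rw (ufatRadius X hT V₀ M) x.1 with hc
  have hQD : frameSeq X hT V₀ γ v (γ c) ℓ ⊆ ballFin X xe Rw ×ˢ Dpl := frameSeq_subset_of_room X hT V₀ γ hdeep hroomD
  have hQπ : ∀ u ∈ frameSeq X hT V₀ γ v (γ c) ℓ, u.1 ∈ ballFin X xe Rw := fun u hu => (Finset.mem_product.1 (hQD hu)).1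
  obtain ⟨hFQ, hdisj, h3⟩ := deep_h3 X hT V₀ hMℓ hlink (Lo := lo - ((j : ℕ) : Site 2)) (Hi := hi + ((j : ℕ) : Site 2)) hWD γ hγ hQD hQπ a τ'
  refine ⟨γ, frameSeq X hT V₀ γ v (γ c) ℓ, _, hγ, ?_, hQD, hdisj, h3⟩
  exact (fatFace_subset_of_room X hT V₀ γ hdeep hroomT).trans hTsub

end BoxProdZ2

end Transplant

end Summit.CriticalPhenomena.PercolationContinuityZ3.Theorems

end
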